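import Mathlib.Algebra.Group.Basic
import Mathlib.Data.Finset.Defs
import Mathlib.Order.Fin.Basic

/-!
# Ladder duality via order-reversing reindexing (support file, siege k17: Mathlib API route)

Item `stmt-MatrixMultiplication-14308` (`FourierTwoFamiliesModP.PrimeTwoFamilies`, CKSU 2005
Conj. 4.7 with prime cyclic hosts), line Sketch, registered stub `isLadder_reverse`.

A LADDER is an ordered family `(X c, Y c)_{c < r}` of finite subsets of an additive commutative
group with

* (`hW`, directness) every class is a direct pair: `(x - x') + (y - y') = 0` forces `x = x'` and
  `y = y'` for `x, x' ∈ X c`, `y, y' ∈ Y c`;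
* (`hL`, one-directional separation) for `p < q` the cross differences `y' - x'`
  (`x' ∈ X p`, `y' ∈ Y q`) avoid every diagonal difference `y - x` (`x ∈ X c`, `y ∈ Y c`).

This file proves the duality `(X, Y) ↦ (Y ∘ Fin.rev, X ∘ Fin.rev)` through the Mathlib order API:
the two clauses are transported along an arbitrary STRICTLY ANTITONE reindexing `e : Fin s → Fin r`
with the sides swapped (`ladder_swap_comp_strictAnti`: differences are negated by `neg_sub` /
`neg_inj`, the order hypothesis `p < q` becomes `e q < e p` by `StrictAnti`), and the stub is the
special case `e = Fin.rev`, `Fin.rev_strictAnti`.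
-/

-- single-conjunct summit: the mandated namespace repeats `MatrixMultiplication` (summit = sub-problem).
set_option linter.dupNamespace false

namespace Summit.MatrixMultiplication.MatrixMultiplication.Theorems.PrimeTwoFamilies.LadderReverseK17

section Transport

variable {G : Type*} [AddCommGroup G]

/-- A coincidence of differences is preserved by swapping minuend and subtrahend on both sides
(`neg_sub`, `neg_inj`). -/
theorem sub_eq_sub_swap {x y x' y' : G} (h : y - x = y' - x') : x - y = x' - y' :=
  neg_inj.1 (by rwa [neg_sub, neg_sub])

/-- **Transport along a strictly antitone reindexing, sides swapped.**  If `(X c, Y c)_{c < r}` is a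
ladder and `e : Fin s → Fin r` is strictly antitone, then `(Y (e c), X (e c))_{c < s}` is a ladder:
directness of a class is symmetric in its two sides (commute the summands, `add_comm`, and swap the
conclusions, `And.symm`), and for `p < q` we have `e q < e p` (`StrictAnti`), so the separation
clause of the original family at `(e c; e q, e p)` — read with minuend and subtrahend swapped
(`sub_eq_sub_swap`) — is the separation clause of the new family at `(c; p, q)`. -/
theorem ladder_swap_comp_strictAnti {r s : ℕ} (X Y : Fin r → Finset G)
    (hW : ∀ c : Fin r, ∀ x ∈ X c, ∀ x' ∈ X c, ∀ y ∈ Y c, ∀ y' ∈ Y c,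
      (x - x') + (y - y') = 0 → x = x' ∧ y = y')
    (hL : ∀ c p q : Fin r, p < q → ∀ x ∈ X c, ∀ y ∈ Y c, ∀ x' ∈ X p, ∀ y' ∈ Y q,
      y - x ≠ y' - x')
    {e : Fin s → Fin r} (he : StrictAnti e) :
    (∀ c : Fin s, ∀ x ∈ Y (e c), ∀ x' ∈ Y (e c), ∀ y ∈ X (e c), ∀ y' ∈ X (e c),
        (x - x') + (y - y') = 0 → x = x' ∧ y = y') ∧
    (∀ c p q : Fin s, p < q → ∀ x ∈ Y (e c), ∀ y ∈ X (e c), ∀ x' ∈ Y (e p), ∀ y' ∈ X (e q),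
        y - x ≠ y' - x') :=
  ⟨fun c x hx x' hx' y hy y' hy' h0 =>
      (hW (e c) y hy y' hy' x hx x' hx' ((add_comm _ _).trans h0)).symm,
    fun c p q hpq x hx y hy x' hx' y' hy' h0 =>
      hL (e c) (e q) (e p) (he hpq) y hy x hx y' hy' x' hx' (sub_eq_sub_swap h0)⟩

end Transport

/-- **Ladder duality** (registered stub `isLadder_reverse` of line Sketch).  If `(X c, Y c)_{c < r}`
is a ladder — every class direct (`hW`) and one-directionally separated (`hL`) — then so is the
family with the two sides swapped and the class order reversed, `c ↦ (Y (Fin.rev c), X (Fin.rev c))`.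
Mathlib API route: `ladder_swap_comp_strictAnti` at the strictly antitone map `Fin.rev`
(`Fin.rev_strictAnti`). -/
theorem isLadder_reverse {G : Type*} [AddCommGroup G] {r : ℕ} (X Y : Fin r → Finset G)
    (hW : ∀ c : Fin r, ∀ x ∈ X c, ∀ x' ∈ X c, ∀ y ∈ Y c, ∀ y' ∈ Y c,
      (x - x') + (y - y') = 0 → x = x' ∧ y = y')
    (hL : ∀ c p q : Fin r, p < q → ∀ x ∈ X c, ∀ y ∈ Y c, ∀ x' ∈ X p, ∀ y' ∈ Y q,
      y - x ≠ y' - x') :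
    (∀ c : Fin r, ∀ x ∈ Y (Fin.rev c), ∀ x' ∈ Y (Fin.rev c), ∀ y ∈ X (Fin.rev c),
        ∀ y' ∈ X (Fin.rev c), (x - x') + (y - y') = 0 → x = x' ∧ y = y') ∧
    (∀ c p q : Fin r, p < q → ∀ x ∈ Y (Fin.rev c), ∀ y ∈ X (Fin.rev c),
        ∀ x' ∈ Y (Fin.rev p), ∀ y' ∈ X (Fin.rev q), y - x ≠ y' - x') :=
  ladder_swap_comp_strictAnti X Y hW hL Fin.rev_strictAnti

end Summit.MatrixMultiplication.MatrixMultiplication.Theorems.PrimeTwoFamilies.LadderReverseK17
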